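import Mathlib.Tactic.Linarith
import Summits.CriticalPhenomena.PercolationContinuityZ3.Theorems.PercNearOneGluingNoHeavyLowerTailSahiCTCSingletonCoeffs
import Summits.CriticalPhenomena.PercolationContinuityZ3.Theorems.PercNearOneGluingNoHeavyLowerTailSahiCTCLoopSplit
import HarnessLib

/-!
# `NoHeavyLowerTail` (crux stmt-CriticalPhenomena-4575), P3 lane: the LADDER FORM `L₂` FOR A SINGLE COMMON EDGE —
# `e₂·(Π·Y − X·Z) − Θ₁·(Π−Θ₁)·s_us_v ∈ ℕ[s]` for all-live up-sets whose only common 2-set is `{u,v}` (every finite type)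

Support file (seat `prim-l12-p3`, gen 24; `--supports stmt-CriticalPhenomena-4575`).  Memo `run/shared/lean/prim/prim-l12/FROM-prim-l12-p3-g24-VALUE-
LEVEL-TH2K.md` §5.8: expand at the common edge (`…SahiCTCEdgeHarris.gf_sections`), write the 16 slices in product form, and bound them by the up-set
Harris blocks (`…SahiCTCHarrisUpGround`), the cross-defect lemma, the cube counts (L1)–(L4) (`…SahiCTCCubeCounts`) and (L5) (`…SahiCTCSingletonCoeffs`).
* (`gf_singleton_empty`, `gf_empty` are reused from `…SahiCTCLoopSplit`);
* **`coeff_ladder_two_singleEdge_nonneg`** : the theorem (one `ring` identity `key` + termwise nonnegativity).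
With `…SahiCTCCoLevelTwoSplit.coeff_Mtwo_nonneg_of_ladder` it gives the co-level-2 row `M₂ ∈ ℕ[s]` for every pair of up-sets whose all-live parts
share exactly one 2-set (`…SahiCTCCoLevelTwoSingle`).  Nothing is asserted about the crux.
-/

namespace Summit.CriticalPhenomena.PercolationContinuityZ3.Theorems.SahiCTCForms

open Finset MvPolynomial SahiCTCGenFun

variable {α : Type*} [DecidableEq α] [Fintype α]

/-! ### The theorem -/

/-- **The ladder form for a single common edge**: for all-live up-sets `𝒳, 𝒵` whose only common 2-set is `{u,v}`,
`e₂·(Π·GF(𝒳∩𝒵) − GF(𝒳)·GF(𝒵)) − Θ₁·(Π − Θ₁)·GF(common 2-sets) ∈ ℕ[s]` (memo g24 §5.8). [this work] -/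
theorem coeff_ladder_two_singleEdge_nonneg {𝒳 𝒵 : Finset (Finset α)} (h𝒳 : IsUpperSet (𝒳 : Set (Finset α)))
    (h𝒵 : IsUpperSet (𝒵 : Set (Finset α))) (hl𝒳 : ∀ S ∈ 𝒳, 2 ≤ #S) (hl𝒵 : ∀ S ∈ 𝒵, 2 ≤ #S) {u v : α} (huv : u ≠ v)
    (he𝒳 : {u, v} ∈ 𝒳) (he𝒵 : {u, v} ∈ 𝒵) (hW : ((𝒳 ∩ 𝒵).filter fun S => #S = 2) = {{u, v}}) (n : α →₀ ℕ) :
    0 ≤ (ee 2 * (PiP * gf (𝒳 ∩ 𝒵) - gf 𝒳 * gf 𝒵)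
      - Th1 * (PiP - Th1) * gf ((𝒳 ∩ 𝒵).filter fun S => #S = 2)).coeff n := by
  obtain ⟨G, hG⟩ : ∃ G : Finset α, G = (univ.erase u).erase v := ⟨_, rfl⟩
  obtain ⟨X0, hX0⟩ : ∃ F : Finset (Finset α), F = G.powerset.filter fun S => S ∈ 𝒳 := ⟨_, rfl⟩
  obtain ⟨Xu, hXu⟩ : ∃ F : Finset (Finset α), F = G.powerset.filter fun S => insert u S ∈ 𝒳 := ⟨_, rfl⟩
  obtain ⟨Xv, hXv⟩ : ∃ F : Finset (Finset α), F = G.powerset.filter fun S => insert v S ∈ 𝒳 := ⟨_, rfl⟩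
  obtain ⟨Z0, hZ0⟩ : ∃ F : Finset (Finset α), F = G.powerset.filter fun S => S ∈ 𝒵 := ⟨_, rfl⟩
  obtain ⟨Zu, hZu⟩ : ∃ F : Finset (Finset α), F = G.powerset.filter fun S => insert u S ∈ 𝒵 := ⟨_, rfl⟩
  obtain ⟨Zv, hZv⟩ : ∃ F : Finset (Finset α), F = G.powerset.filter fun S => insert v S ∈ 𝒵 := ⟨_, rfl⟩
  have he𝒴 : ({u, v} : Finset α) ∈ 𝒳 ∩ 𝒵 := mem_inter.2 ⟨he𝒳, he𝒵⟩
  have h𝒴 : IsUpperSet ((𝒳 ∩ 𝒵 : Finset (Finset α)) : Set (Finset α)) := by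
    rw [coe_inter]; exact h𝒳.inter h𝒵
  -- support and up-closure of the sections inside G
  have sub_of : ∀ {p : Finset α → Prop} [DecidablePred p], ∀ T ∈ G.powerset.filter p, T ⊆ G :=
    fun T hT => mem_powerset.1 (mem_filter.1 hT).1
  have hX0G : ∀ T ∈ X0, T ⊆ G := by rw [hX0]; exact sub_of
  have hXuG : ∀ T ∈ Xu, T ⊆ G := by rw [hXu]; exact sub_of
  have hXvG : ∀ T ∈ Xv, T ⊆ G := by rw [hXv]; exact sub_of
  have hZ0G : ∀ T ∈ Z0, T ⊆ G := by rw [hZ0]; exact sub_of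
  have hZuG : ∀ T ∈ Zu, T ⊆ G := by rw [hZu]; exact sub_of
  have hZvG : ∀ T ∈ Zv, T ⊆ G := by rw [hZv]; exact sub_of
  have up0 : ∀ {𝒲 : Finset (Finset α)}, IsUpperSet (𝒲 : Set (Finset α)) →
      ∀ A ∈ G.powerset.filter (fun S => S ∈ 𝒲), ∀ B : Finset α, A ⊆ B → B ⊆ G → B ∈ G.powerset.filter (fun S => S ∈ 𝒲) := by
    intro 𝒲 h𝒲 A hA B hAB hBG
    exact mem_filter.2 ⟨mem_powerset.2 hBG, h𝒲 hAB (mem_filter.1 hA).2⟩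
  have upw : ∀ {𝒲 : Finset (Finset α)} (w : α), IsUpperSet (𝒲 : Set (Finset α)) →
      ∀ A ∈ G.powerset.filter (fun S => insert w S ∈ 𝒲), ∀ B : Finset α, A ⊆ B → B ⊆ G →
        B ∈ G.powerset.filter (fun S => insert w S ∈ 𝒲) := by
    intro 𝒲 w h𝒲 A hA B hAB hBG
    exact mem_filter.2 ⟨mem_powerset.2 hBG, h𝒲 (insert_subset_insert w hAB) (mem_filter.1 hA).2⟩
  have hX0Xu : X0 ⊆ Xu := by
    rw [hX0, hXu]; intro S hS
    exact mem_filter.2 ⟨(mem_filter.1 hS).1, h𝒳 (subset_insert u S) (mem_filter.1 hS).2⟩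
  have hX0Xv : X0 ⊆ Xv := by
    rw [hX0, hXv]; intro S hS
    exact mem_filter.2 ⟨(mem_filter.1 hS).1, h𝒳 (subset_insert v S) (mem_filter.1 hS).2⟩
  have hZ0Zu : Z0 ⊆ Zu := by
    rw [hZ0, hZu]; intro S hS
    exact mem_filter.2 ⟨(mem_filter.1 hS).1, h𝒵 (subset_insert u S) (mem_filter.1 hS).2⟩
  have hZ0Zv : Z0 ⊆ Zv := by
    rw [hZ0, hZv]; intro S hS
    exact mem_filter.2 ⟨(mem_filter.1 hS).1, h𝒵 (subset_insert v S) (mem_filter.1 hS).2⟩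
  -- the empty set lies in neither section (all-live)
  have hu𝒳 : ({u} : Finset α) ∉ 𝒳 := fun h => by have h2 := hl𝒳 _ h; rw [card_singleton] at h2; omega
  have hu𝒵 : ({u} : Finset α) ∉ 𝒵 := fun h => by have h2 := hl𝒵 _ h; rw [card_singleton] at h2; omega
  have hv𝒳 : ({v} : Finset α) ∉ 𝒳 := fun h => by have h2 := hl𝒳 _ h; rw [card_singleton] at h2; omega
  have he𝒳' : (∅ : Finset α) ∉ 𝒳 := fun h => by have h2 := hl𝒳 _ h; rw [card_empty] at h2; omega
  have hemp0 : (∅ : Finset α) ∈ G.powerset \ (X0 ∪ Z0) := by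
    rw [mem_sdiff, mem_union, hX0, hZ0]
    refine ⟨mem_powerset.2 (empty_subset _), ?_⟩
    rintro (h | h)
    · exact he𝒳' (mem_filter.1 h).2
    · have h2 := hl𝒵 _ (mem_filter.1 h).2; rw [card_empty] at h2; omega
  have hempu : (∅ : Finset α) ∈ G.powerset \ (Xu ∪ Zu) := by
    rw [mem_sdiff, mem_union, hXu, hZu]
    refine ⟨mem_powerset.2 (empty_subset _), ?_⟩
    rintro (h | h)
    · exact hu𝒳 (by simpa using (mem_filter.1 h).2)
    · exact hu𝒵 (by simpa using (mem_filter.1 h).2)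
  have hempv : (∅ : Finset α) ∈ G.powerset \ (Xv ∪ Zv) := by
    rw [mem_sdiff, mem_union, hXv, hZv]
    refine ⟨mem_powerset.2 (empty_subset _), ?_⟩
    rintro (h | h)
    · exact hv𝒳 (by simpa using (mem_filter.1 h).2)
    · have h2 := hl𝒵 _ (by simpa using (mem_filter.1 h).2); rw [card_singleton] at h2; omega
  -- generating functions of the derived families
  have gN0 : gf ((G.powerset \ (X0 ∪ Z0)).erase ∅) = gf G.powerset - gf X0 - gf Z0 + gf (X0 ∩ Z0) - 1 := by
    rw [gf_erase_empty hemp0, gf_sdiff_eq (union_subset (fun T hT => mem_powerset.2 (hX0G T hT))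
      (fun T hT => mem_powerset.2 (hZ0G T hT)))]
    have h' : gf (X0 ∪ Z0) = gf X0 + gf Z0 - gf (X0 ∩ Z0) := by rw [← gf_union_add_gf_inter X0 Z0]; ring
    rw [h']; ring
  have gNu : gf ((G.powerset \ (Xu ∪ Zu)).erase ∅) = gf G.powerset - gf Xu - gf Zu + gf (Xu ∩ Zu) - 1 := by
    rw [gf_erase_empty hempu, gf_sdiff_eq (union_subset (fun T hT => mem_powerset.2 (hXuG T hT))
      (fun T hT => mem_powerset.2 (hZuG T hT)))]
    have h' : gf (Xu ∪ Zu) = gf Xu + gf Zu - gf (Xu ∩ Zu) := by rw [← gf_union_add_gf_inter Xu Zu]; ring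
    rw [h']; ring
  have gNv : gf ((G.powerset \ (Xv ∪ Zv)).erase ∅) = gf G.powerset - gf Xv - gf Zv + gf (Xv ∩ Zv) - 1 := by
    rw [gf_erase_empty hempv, gf_sdiff_eq (union_subset (fun T hT => mem_powerset.2 (hXvG T hT))
      (fun T hT => mem_powerset.2 (hZvG T hT)))]
    have h' : gf (Xv ∪ Zv) = gf Xv + gf Zv - gf (Xv ∩ Zv) := by rw [← gf_union_add_gf_inter Xv Zv]; ring
    rw [h']; ring
  -- sections of 𝒳, 𝒵, 𝒴 = 𝒳 ∩ 𝒵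
  have sX := gf_sections 𝒳 huv
  have sZ := gf_sections 𝒵 huv
  have sY := gf_sections (𝒳 ∩ 𝒵) huv
  rw [← hG] at sX sZ sY
  rw [sections_pair_eq h𝒳 he𝒳 G, ← hX0, ← hXu, ← hXv] at sX
  rw [sections_pair_eq h𝒵 he𝒵 G, ← hZ0, ← hZu, ← hZv] at sZ
  rw [sections_pair_eq h𝒴 he𝒴 G, filter_mem_inter_eq 𝒳 𝒵 G (fun S => S), filter_mem_inter_eq 𝒳 𝒵 G (fun S => insert v S),
    filter_mem_inter_eq 𝒳 𝒵 G (fun S => insert u S), ← hX0, ← hXu, ← hXv, ← hZ0, ← hZu, ← hZv] at sY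
  have sP := PiP_sections (α := α) huv
  rw [← hG] at sP
  -- u, v ∉ G
  have huG : u ∉ G := by rw [hG]; simp
  have hvG : v ∉ G := by rw [hG]; simp [huv.symm]
  have hcard_v : ∀ S ∈ G.powerset, #(insert v S) = #S + 1 := fun S hS =>
    card_insert_of_notMem fun h => hvG (mem_powerset.1 hS h)
  have hcard_uv : ∀ S ∈ G.powerset, #(insert u (insert v S)) = #S + 2 := fun S hS => by
    rw [card_insert_of_notMem, hcard_v S hS]
    rw [mem_insert, not_or]; exact ⟨huv, fun h => huG (mem_powerset.1 hS h)⟩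
  have hcard_u : ∀ S ∈ G.powerset, #(insert u S) = #S + 1 := fun S hS =>
    card_insert_of_notMem fun h => huG (mem_powerset.1 hS h)
  -- sections of e₂ and Θ₁
  have hbs : ∀ (p : ℕ → Prop) [DecidablePred p] (S : Finset α), S ∈ (bySize p : Finset (Finset α)) ↔ p #S := fun p _ S => by
    unfold bySize; simp only [mem_filter, mem_powerset, subset_univ, true_and]
  have f20 : (G.powerset.filter fun S => S ∈ (bySize (· = 2) : Finset (Finset α))) = G.powerset.filter fun S => #S = 2 :=
    filter_congr fun S _ => by rw [hbs]
  have f2v : (G.powerset.filter fun S => insert v S ∈ (bySize (· = 2) : Finset (Finset α))) = G.powerset.filter fun S => #S = 1 :=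
    filter_congr fun S hS => by rw [hbs]; simp only [hcard_v S hS]; omega
  have f2u : (G.powerset.filter fun S => insert u S ∈ (bySize (· = 2) : Finset (Finset α))) = G.powerset.filter fun S => #S = 1 :=
    filter_congr fun S hS => by rw [hbs]; simp only [hcard_u S hS]; omega
  have f2uv : (G.powerset.filter fun S => insert u (insert v S) ∈ (bySize (· = 2) : Finset (Finset α))) = {∅} := by
    ext S; simp only [mem_filter, mem_singleton, hbs]
    constructor
    · rintro ⟨hS, h2⟩; rw [hcard_uv S hS] at h2; exact card_eq_zero.1 (by omega)
    · rintro rfl; exact ⟨mem_powerset.2 (empty_subset _), by rw [hcard_uv ∅ (mem_powerset.2 (empty_subset _)), card_empty]⟩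
  have f10 : gf (G.powerset.filter fun S => S ∈ (bySize (· ≤ 1) : Finset (Finset α))) = 1 + gf (G.powerset.filter fun S => #S = 1) := by
    rw [← gf_singleton_empty, ← gf_union]
    · congr 1; ext S; simp only [mem_filter, mem_union, mem_singleton, hbs]
      constructor
      · rintro ⟨hS, h1⟩
        rcases Nat.lt_or_ge #S 1 with h | h
        · exact Or.inl (card_eq_zero.1 (by omega))
        · exact Or.inr ⟨hS, by omega⟩
      · rintro (rfl | ⟨hS, h1⟩)
        · exact ⟨mem_powerset.2 (empty_subset _), by simp⟩
        · exact ⟨hS, by omega⟩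
    · exact disjoint_left.2 fun S h1 h2 => by
        rw [mem_singleton] at h1; subst h1; have := (mem_filter.1 h2).2; simp at this
  have f1v : (G.powerset.filter fun S => insert v S ∈ (bySize (· ≤ 1) : Finset (Finset α))) = {∅} := by
    ext S; simp only [mem_filter, mem_singleton, hbs]
    constructor
    · rintro ⟨hS, h2⟩; rw [hcard_v S hS] at h2; exact card_eq_zero.1 (by omega)
    · rintro rfl; exact ⟨mem_powerset.2 (empty_subset _), by rw [hcard_v ∅ (mem_powerset.2 (empty_subset _)), card_empty]⟩
  have f1u : (G.powerset.filter fun S => insert u S ∈ (bySize (· ≤ 1) : Finset (Finset α))) = {∅} := by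
    ext S; simp only [mem_filter, mem_singleton, hbs]
    constructor
    · rintro ⟨hS, h2⟩; rw [hcard_u S hS] at h2; exact card_eq_zero.1 (by omega)
    · rintro rfl; exact ⟨mem_powerset.2 (empty_subset _), by rw [hcard_u ∅ (mem_powerset.2 (empty_subset _)), card_empty]⟩
  have f1uv : (G.powerset.filter fun S => insert u (insert v S) ∈ (bySize (· ≤ 1) : Finset (Finset α))) = ∅ :=
    filter_eq_empty_iff.2 fun S hS h => by rw [hbs, hcard_uv S hS] at h; omega
  have see2 : (ee 2 : MvPolynomial α ℤ) = gf (G.powerset.filter fun S => #S = 2) + X v * gf (G.powerset.filter fun S => #S = 1) + X u * (gf (G.powerset.filter fun S => #S = 1) + X v * 1) := by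
    unfold ee; rw [gf_sections _ huv, ← hG, f20, f2v, f2u, f2uv, gf_singleton_empty]
  have sTh1 : (Th1 : MvPolynomial α ℤ) = (1 + gf (G.powerset.filter fun S => #S = 1)) + X v * 1 + X u * (1 + X v * 0) := by
    unfold Th1; rw [gf_sections _ huv, ← hG, f10, f1v, f1u, f1uv, gf_singleton_empty, gf_empty]
  -- Π_G = 1 + E1 + D2
  have hPsplit : gf G.powerset = 1 + gf (G.powerset.filter fun S => #S = 1) + gf (G.powerset.filter fun S => 2 ≤ #S) := by
    rw [← gf_singleton_empty, ← gf_union, ← gf_union]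
    · congr 1; ext S; simp only [mem_union, mem_filter, mem_singleton, mem_powerset]
      constructor
      · intro hS
        rcases Nat.lt_or_ge #S 1 with h | h
        · exact Or.inl (Or.inl (card_eq_zero.1 (by omega)))
        · rcases Nat.lt_or_ge #S 2 with h2 | h2
          · exact Or.inl (Or.inr ⟨hS, by omega⟩)
          · exact Or.inr ⟨hS, h2⟩
      · rintro ((rfl | ⟨hS, _⟩) | ⟨hS, _⟩)
        · exact empty_subset _
        · exact hS
        · exact hS
    · rw [disjoint_left]; rintro S hS h2
      have h2' := (mem_filter.1 h2).2
      rcases mem_union.1 hS with h | h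
      · rw [mem_singleton] at h; subst h; simp at h2'
      · have := (mem_filter.1 h).2; omega
    · exact disjoint_left.2 fun S h1 h2 => by
        rw [mem_singleton] at h1; subst h1; have := (mem_filter.1 h2).2; simp at this
  -- the common 2-sets
  have hWgf : gf ((𝒳 ∩ 𝒵).filter fun S => #S = 2) = X u * X v := by rw [hW, gf_pair_eq huv]
  -- the slice decomposition
  have key : ee 2 * (PiP * gf (𝒳 ∩ 𝒵) - gf 𝒳 * gf 𝒵) - Th1 * (PiP - Th1) * gf ((𝒳 ∩ 𝒵).filter fun S => #S = 2) =
      gf (G.powerset.filter fun S => #S = 2) * (gf G.powerset * gf (X0 ∩ Z0) - gf X0 * gf Z0)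
      + X u * (gf (G.powerset.filter fun S => #S = 2) * ((gf G.powerset * gf (X0 ∩ Z0) - gf X0 * gf Z0) + (gf G.powerset * gf (Xu ∩ Zu) - gf Xu * gf Zu) + gf (Xu \ X0) * gf (Zu \ Z0)) + gf (G.powerset.filter fun S => #S = 1) * (gf G.powerset * gf (X0 ∩ Z0) - gf X0 * gf Z0))
      + X v * (gf (G.powerset.filter fun S => #S = 2) * ((gf G.powerset * gf (X0 ∩ Z0) - gf X0 * gf Z0) + (gf G.powerset * gf (Xv ∩ Zv) - gf Xv * gf Zv) + gf (Xv \ X0) * gf (Zv \ Z0)) + gf (G.powerset.filter fun S => #S = 1) * (gf G.powerset * gf (X0 ∩ Z0) - gf X0 * gf Z0))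
      + X u * X u * (gf (G.powerset.filter fun S => #S = 2) * (gf G.powerset * gf (Xu ∩ Zu) - gf Xu * gf Zu) + gf (G.powerset.filter fun S => #S = 1) * ((gf G.powerset * gf (X0 ∩ Z0) - gf X0 * gf Z0) + (gf G.powerset * gf (Xu ∩ Zu) - gf Xu * gf Zu) + gf (Xu \ X0) * gf (Zu \ Z0)))
      + X v * X v * (gf (G.powerset.filter fun S => #S = 2) * (gf G.powerset * gf (Xv ∩ Zv) - gf Xv * gf Zv) + gf (G.powerset.filter fun S => #S = 1) * ((gf G.powerset * gf (X0 ∩ Z0) - gf X0 * gf Z0) + (gf G.powerset * gf (Xv ∩ Zv) - gf Xv * gf Zv) + gf (Xv \ X0) * gf (Zv \ Z0)))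
      + X u * X u * X u * (gf (G.powerset.filter fun S => #S = 1) * (gf G.powerset * gf (Xu ∩ Zu) - gf Xu * gf Zu))
      + X v * X v * X v * (gf (G.powerset.filter fun S => #S = 1) * (gf G.powerset * gf (Xv ∩ Zv) - gf Xv * gf Zv))
      + X u * X u * X u * X v * ((gf (G.powerset.filter fun S => #S = 1) * gf G.powerset - (gf (G.powerset.filter fun S => #S = 1) + 2 * gf (G.powerset.filter fun S => 2 ≤ #S))) + gf (G.powerset.filter fun S => 2 ≤ #S) + gf (G.powerset.filter fun S => #S = 1) * gf G.powerset * gf ((G.powerset \ (Xu ∪ Zu)).erase ∅) + (gf G.powerset * gf (Xu ∩ Zu) - gf Xu * gf Zu))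
      + X u * X v * X v * X v * ((gf (G.powerset.filter fun S => #S = 1) * gf G.powerset - (gf (G.powerset.filter fun S => #S = 1) + 2 * gf (G.powerset.filter fun S => 2 ≤ #S))) + gf (G.powerset.filter fun S => 2 ≤ #S) + gf (G.powerset.filter fun S => #S = 1) * gf G.powerset * gf ((G.powerset \ (Xv ∪ Zv)).erase ∅) + (gf G.powerset * gf (Xv ∩ Zv) - gf Xv * gf Zv))
      + X u * X u * X u * X v * X v * (gf G.powerset * gf ((G.powerset \ (Xu ∪ Zu)).erase ∅))
      + X u * X u * X v * X v * X v * (gf G.powerset * gf ((G.powerset \ (Xv ∪ Zv)).erase ∅))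
      + X u * X u * X v * X v * ((gf (G.powerset.filter fun S => #S = 1) * gf G.powerset - (gf (G.powerset.filter fun S => #S = 1) + 2 * gf (G.powerset.filter fun S => 2 ≤ #S))) + gf (G.powerset.filter fun S => #S = 1) * gf G.powerset * (gf ((G.powerset \ (Xu ∪ Zu)).erase ∅) + gf ((G.powerset \ (Xv ∪ Zv)).erase ∅)) + (((gf G.powerset * gf (Xu ∩ Zv) - gf Xu * gf Zv) + (gf G.powerset * gf (Xv ∩ Zu) - gf Xv * gf Zu) + gf G.powerset * (gf ((G.powerset \ (X0 ∪ Z0)).erase ∅) + gf (Xu ∩ Zu) + gf (Xv ∩ Zv) - gf (Xu ∩ Zv) - gf (Xv ∩ Zu))) - gf (G.powerset.filter fun S => #S = 1)))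
      + X u * X u * X v * (((gf (G.powerset.filter fun S => #S = 2) * gf G.powerset + 2 * gf (G.powerset.filter fun S => #S = 2)) - 2 * gf (G.powerset.filter fun S => 2 ≤ #S)) + gf (G.powerset.filter fun S => #S = 2) * gf G.powerset * gf ((G.powerset \ (Xu ∪ Zu)).erase ∅) + gf (G.powerset.filter fun S => #S = 1) * (((gf G.powerset * gf (Xu ∩ Zv) - gf Xu * gf Zv) + (gf G.powerset * gf (Xv ∩ Zu) - gf Xv * gf Zu) + gf G.powerset * (gf ((G.powerset \ (X0 ∪ Z0)).erase ∅) + gf (Xu ∩ Zu) + gf (Xv ∩ Zv) - gf (Xu ∩ Zv) - gf (Xv ∩ Zu))) - gf (G.powerset.filter fun S => #S = 1)) + (gf (G.powerset.filter fun S => #S = 1) * gf (G.powerset.filter fun S => #S = 1) - 2 * gf (G.powerset.filter fun S => #S = 2)) + gf (G.powerset.filter fun S => #S = 1) * (gf G.powerset * gf (Xu ∩ Zu) - gf Xu * gf Zu) + ((gf G.powerset * gf (X0 ∩ Z0) - gf X0 * gf Z0) + (gf G.powerset * gf (Xu ∩ Zu) - gf Xu * gf Zu) + gf (Xu \ X0)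 * gf (Zu \ Z0)))
      + X u * X v * X v * (((gf (G.powerset.filter fun S => #S = 2) * gf G.powerset + 2 * gf (G.powerset.filter fun S => #S = 2)) - 2 * gf (G.powerset.filter fun S => 2 ≤ #S)) + gf (G.powerset.filter fun S => #S = 2) * gf G.powerset * gf ((G.powerset \ (Xv ∪ Zv)).erase ∅) + gf (G.powerset.filter fun S => #S = 1) * (((gf G.powerset * gf (Xu ∩ Zv) - gf Xu * gf Zv) + (gf G.powerset * gf (Xv ∩ Zu) - gf Xv * gf Zu) + gf G.powerset * (gf ((G.powerset \ (X0 ∪ Z0)).erase ∅) + gf (Xu ∩ Zu) + gf (Xv ∩ Zv) - gf (Xu ∩ Zv) - gf (Xv ∩ Zu))) - gf (G.powerset.filter fun S => #S = 1)) + (gf (G.powerset.filter fun S => #S = 1) * gf (G.powerset.filter fun S => #S = 1) - 2 * gf (G.powerset.filter fun S => #S = 2)) + gf (G.powerset.filter fun S => #S = 1) * (gf G.powerset * gf (Xv ∩ Zv) - gf Xv * gf Zv) + ((gf G.powerset * gf (X0 ∩ Z0) - gf X0 * gf Z0) + (gf G.powerset * gf (Xv ∩ Zv) - gf Xv * gf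 Zv) + gf (Xv \ X0) * gf (Zv \ Z0)))
      + X u * X v * ((gf (G.powerset.filter fun S => #S = 2) * (gf G.powerset + gf (G.powerset.filter fun S => #S = 1)) - gf (G.powerset.filter fun S => 2 ≤ #S) * (1 + gf (G.powerset.filter fun S => #S = 1))) + gf (G.powerset.filter fun S => #S = 2) * (((gf G.powerset * gf (Xu ∩ Zv) - gf Xu * gf Zv) + (gf G.powerset * gf (Xv ∩ Zu) - gf Xv * gf Zu) + gf G.powerset * (gf ((G.powerset \ (X0 ∪ Z0)).erase ∅) + gf (Xu ∩ Zu) + gf (Xv ∩ Zv) - gf (Xu ∩ Zv) - gf (Xv ∩ Zu))) - gf (G.powerset.filter fun S => #S = 1)) + gf (G.powerset.filter fun S => #S = 1) * (((gf G.powerset * gf (X0 ∩ Z0) - gf X0 * gf Z0) + (gf G.powerset * gf (Xv ∩ Zv) - gf Xv * gf Zv) + gf (Xv \ X0) * gf (Zv \ Z0)) + ((gf G.powerset * gf (X0 ∩ Z0) - gf X0 * gf Z0) + (gf G.powerset * gf (Xu ∩ Zu) - gf Xu * gf Zu) + gf (Xu \ X0) * gf (Zu \ Z0))) + (gf G.powerset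 * gf (X0 ∩ Z0) - gf X0 * gf Z0)) := by
    rw [hWgf, see2, sTh1, sX, sZ, sY, sP, gN0, gNu, gNv, gf_sdiff_eq hX0Xu, gf_sdiff_eq hZ0Zu, gf_sdiff_eq hX0Xv, gf_sdiff_eq hZ0Zv,
      hPsplit]
    ring
  rw [key]
  -- nonnegativity of the pieces
  have nP : ∀ m, 0 ≤ (gf G.powerset).coeff m := coeff_gf_nonneg _
  have h00 : ∀ m, 0 ≤ (gf G.powerset * gf (X0 ∩ Z0) - gf X0 * gf Z0).coeff m := by
    intro m; rw [hX0, hZ0]; exact coeff_harris_upIn_sub_nonneg sub_of sub_of (up0 h𝒳) (up0 h𝒵) m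
  have huu : ∀ m, 0 ≤ (gf G.powerset * gf (Xu ∩ Zu) - gf Xu * gf Zu).coeff m := by
    intro m; rw [hXu, hZu]; exact coeff_harris_upIn_sub_nonneg sub_of sub_of (upw u h𝒳) (upw u h𝒵) m
  have hvv : ∀ m, 0 ≤ (gf G.powerset * gf (Xv ∩ Zv) - gf Xv * gf Zv).coeff m := by
    intro m; rw [hXv, hZv]; exact coeff_harris_upIn_sub_nonneg sub_of sub_of (upw v h𝒳) (upw v h𝒵) m
  have huv' : ∀ m, 0 ≤ (gf G.powerset * gf (Xu ∩ Zv) - gf Xu * gf Zv).coeff m := by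
    intro m; rw [hXu, hZv]; exact coeff_harris_upIn_sub_nonneg sub_of sub_of (upw u h𝒳) (upw v h𝒵) m
  have hvu' : ∀ m, 0 ≤ (gf G.powerset * gf (Xv ∩ Zu) - gf Xv * gf Zu).coeff m := by
    intro m; rw [hXv, hZu]; exact coeff_harris_upIn_sub_nonneg sub_of sub_of (upw v h𝒳) (upw u h𝒵) m
  have hD : ∀ m, 0 ≤ (gf ((G.powerset \ (X0 ∪ Z0)).erase ∅) + gf (Xu ∩ Zu) + gf (Xv ∩ Zv)
      - gf (Xu ∩ Zv) - gf (Xv ∩ Zu)).coeff m := by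
    intro m; rw [hX0, hZ0, hXu, hXv, hZu, hZv]; exact coeff_crossDefect_nonneg h𝒳 h𝒵 hl𝒳 G m
  have nXu : ∀ m, 0 ≤ (X u : MvPolynomial α ℤ).coeff m := coeff_X_nonneg' u
  have nXv : ∀ m, 0 ≤ (X v : MvPolynomial α ℤ).coeff m := coeff_X_nonneg' v
  have nadd : ∀ {P Q : MvPolynomial α ℤ}, (∀ m, 0 ≤ P.coeff m) → (∀ m, 0 ≤ Q.coeff m) → ∀ m, 0 ≤ (P + Q).coeff m :=
    fun hP hQ m => by rw [coeff_add]; exact add_nonneg (hP m) (hQ m)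
  have nE1 : ∀ m, 0 ≤ (gf (G.powerset.filter fun S => #S = 1)).coeff m := coeff_gf_nonneg _
  have nE2 : ∀ m, 0 ≤ (gf (G.powerset.filter fun S => #S = 2)).coeff m := coeff_gf_nonneg _
  have nD2 : ∀ m, 0 ≤ (gf (G.powerset.filter fun S => 2 ≤ #S)).coeff m := coeff_gf_nonneg _
  have nL1 : ∀ m, 0 ≤ ((gf (G.powerset.filter fun S => #S = 1) * gf G.powerset - (gf (G.powerset.filter fun S => #S = 1) + 2 * gf (G.powerset.filter fun S => 2 ≤ #S)))).coeff m := fun m => by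
    rw [coeff_sub, sub_nonneg]; exact coeff_singles_add_two_mul_le G m
  have nL2 : ∀ m, 0 ≤ (((gf (G.powerset.filter fun S => #S = 2) * gf G.powerset + 2 * gf (G.powerset.filter fun S => #S = 2)) - 2 * gf (G.powerset.filter fun S => 2 ≤ #S))).coeff m := fun m => by
    rw [coeff_sub, sub_nonneg]; exact coeff_two_mul_atLeastTwo_le G m
  have nL3 : ∀ m, 0 ≤ ((gf (G.powerset.filter fun S => #S = 1) * gf (G.powerset.filter fun S => #S = 1) - 2 * gf (G.powerset.filter fun S => #S = 2))).coeff m := fun m => by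
    rw [coeff_sub, sub_nonneg]; exact coeff_two_mul_pairs_le_singles_sq G m
  have nL4 : ∀ m, 0 ≤ ((gf (G.powerset.filter fun S => #S = 2) * (gf G.powerset + gf (G.powerset.filter fun S => #S = 1)) - gf (G.powerset.filter fun S => 2 ≤ #S) * (1 + gf (G.powerset.filter fun S => #S = 1)))).coeff m := fun m => by
    rw [coeff_sub, sub_nonneg]; exact coeff_atLeastTwo_mul_le G m
  have nL5 : ∀ m, 0 ≤ ((((gf G.powerset * gf (Xu ∩ Zv) - gf Xu * gf Zv) + (gf G.powerset * gf (Xv ∩ Zu) - gf Xv * gf Zu) + gf G.powerset * (gf ((G.powerset \ (X0 ∪ Z0)).erase ∅) + gf (Xu ∩ Zu) + gf (Xv ∩ Zv) - gf (Xu ∩ Zv) - gf (Xv ∩ Zu))) - gf (G.powerset.filter fun S => #S = 1))).coeff m := fun m => by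
    rw [coeff_sub, sub_nonneg, hX0, hZ0, hXu, hXv, hZu, hZv]; exact coeff_crossDefect_ge_singles h𝒳 h𝒵 hl𝒳 hl𝒵 m
  have nNu : ∀ m, 0 ≤ (gf ((G.powerset \ (Xu ∪ Zu)).erase ∅)).coeff m := coeff_gf_nonneg _
  have nNv : ∀ m, 0 ≤ (gf ((G.powerset \ (Xv ∪ Zv)).erase ∅)).coeff m := coeff_gf_nonneg _
  have nH10 : ∀ m, 0 ≤ (((gf G.powerset * gf (X0 ∩ Z0) - gf X0 * gf Z0) + (gf G.powerset * gf (Xu ∩ Zu) - gf Xu * gf Zu) + gf (Xu \ X0) * gf (Zu \ Z0))).coeff m :=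
    nadd (nadd h00 huu) (coeff_mul_nonneg (coeff_gf_nonneg _) (coeff_gf_nonneg _))
  have nH01 : ∀ m, 0 ≤ (((gf G.powerset * gf (X0 ∩ Z0) - gf X0 * gf Z0) + (gf G.powerset * gf (Xv ∩ Zv) - gf Xv * gf Zv) + gf (Xv \ X0) * gf (Zv \ Z0))).coeff m :=
    nadd (nadd h00 hvv) (coeff_mul_nonneg (coeff_gf_nonneg _) (coeff_gf_nonneg _))
  refine nadd (nadd (nadd (nadd (nadd (nadd (nadd (nadd (nadd (nadd (nadd (nadd (nadd (nadd ?_ ?_) ?_) ?_) ?_) ?_) ?_) ?_) ?_) ?_) ?_) ?_) ?_) ?_) ?_ n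
  · exact coeff_mul_nonneg nE2 h00
  · exact coeff_mul_nonneg nXu (nadd (coeff_mul_nonneg nE2 nH10) (coeff_mul_nonneg nE1 h00))
  · exact coeff_mul_nonneg nXv (nadd (coeff_mul_nonneg nE2 nH01) (coeff_mul_nonneg nE1 h00))
  · exact coeff_mul_nonneg (coeff_mul_nonneg nXu nXu) (nadd (coeff_mul_nonneg nE2 huu) (coeff_mul_nonneg nE1 nH10))
  · exact coeff_mul_nonneg (coeff_mul_nonneg nXv nXv) (nadd (coeff_mul_nonneg nE2 hvv) (coeff_mul_nonneg nE1 nH01))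
  · exact coeff_mul_nonneg (coeff_mul_nonneg (coeff_mul_nonneg nXu nXu) nXu) (coeff_mul_nonneg nE1 huu)
  · exact coeff_mul_nonneg (coeff_mul_nonneg (coeff_mul_nonneg nXv nXv) nXv) (coeff_mul_nonneg nE1 hvv)
  · exact coeff_mul_nonneg (coeff_mul_nonneg (coeff_mul_nonneg (coeff_mul_nonneg nXu nXu) nXu) nXv)
      (nadd (nadd (nadd nL1 nD2) (coeff_mul_nonneg (coeff_mul_nonneg nE1 nP) nNu)) huu)
  · exact coeff_mul_nonneg (coeff_mul_nonneg (coeff_mul_nonneg (coeff_mul_nonneg nXu nXv) nXv) nXv)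
      (nadd (nadd (nadd nL1 nD2) (coeff_mul_nonneg (coeff_mul_nonneg nE1 nP) nNv)) hvv)
  · exact coeff_mul_nonneg (coeff_mul_nonneg (coeff_mul_nonneg (coeff_mul_nonneg (coeff_mul_nonneg nXu nXu) nXu) nXv) nXv) (coeff_mul_nonneg nP nNu)
  · exact coeff_mul_nonneg (coeff_mul_nonneg (coeff_mul_nonneg (coeff_mul_nonneg (coeff_mul_nonneg nXu nXu) nXv) nXv) nXv) (coeff_mul_nonneg nP nNv)
  · exact coeff_mul_nonneg (coeff_mul_nonneg (coeff_mul_nonneg (coeff_mul_nonneg nXu nXu) nXv) nXv)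
      (nadd (nadd nL1 (coeff_mul_nonneg (coeff_mul_nonneg nE1 nP) (nadd nNu nNv))) nL5)
  · exact coeff_mul_nonneg (coeff_mul_nonneg (coeff_mul_nonneg nXu nXu) nXv)
      (nadd (nadd (nadd (nadd (nadd nL2 (coeff_mul_nonneg (coeff_mul_nonneg nE2 nP) nNu)) (coeff_mul_nonneg nE1 nL5)) nL3) (coeff_mul_nonneg nE1 huu)) nH10)
  · exact coeff_mul_nonneg (coeff_mul_nonneg (coeff_mul_nonneg nXu nXv) nXv)
      (nadd (nadd (nadd (nadd (nadd nL2 (coeff_mul_nonneg (coeff_mul_nonneg nE2 nP) nNv)) (coeff_mul_nonneg nE1 nL5)) nL3) (coeff_mul_nonneg nE1 hvv)) nH01)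
  · exact coeff_mul_nonneg (coeff_mul_nonneg nXu nXv)
      (nadd (nadd (nadd nL4 (coeff_mul_nonneg nE2 nL5)) (coeff_mul_nonneg nE1 (nadd nH01 nH10))) h00)

end Summit.CriticalPhenomena.PercolationContinuityZ3.Theorems.SahiCTCForms
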